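import Summits.AtomisticToContinuum.Crystallization.Theorems.FrustratedLawDichotomyStrainedPatchHomCurvLeaf

/-!
# Kernel smoke test of the curvature leaf `curvCheck` (lever (C))

decomp-a2c hand-1 g26.  The six nearest B-family labels of an A-site (`b ∈ {0, −e₀, −e₁, −e₂, −e₀−e₂, −e₁−e₂}`, i.e. `Hb + hcpShift` = the two triads
at unit distance) on the box `U ∈ 0.97128·1 ± 2⁻¹¹` (entries), `ξ ∈ 0 ± 2⁻¹¹`, floor `λ = 2` (the six-bond sum has basal curvature ≈ 8 at hcp⋆): `curvCheck … = true`, decided by the KERNEL (`decide +kernel`; all three radial regimes« enclosures are evaluated per label, the six labels sit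
in the bump regime).  Def-free apart from the literal box data; 0 sorry.  `--supports stmt-AtomisticToContinuum-27623`.
-/

namespace Summit.AtomisticToContinuum.Crystallization.Theorems.FrustratedLawDichotomyStrainedPatchHomCurvLeaf

open Literature.Analysis.ValidatedNumerics.Numerics

/-- Box centre: `U = 0.97128·1` (entries under `Sum.inl`, scaled by `SC = 2⁴⁸`), `ξ = 0`. -/
def cSmoke : (Fin 3 × Fin 3) ⊕ Fin 3 → ℤ :=
  Sum.elim (fun ab => if ab.1 = ab.2 then 273391015379526 else 0) (fun _ => 0)

/-- Box half-width `2⁻¹¹` on all twelve coordinates (`2³⁷` at scale `2⁴⁸`). -/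
def wSmoke : (Fin 3 × Fin 3) ⊕ Fin 3 → ℤ := fun _ => 137438953472

/-- The six nearest B-family labels. -/
def sixLabels : List (Fin 3 → ℤ) :=
  [![0, 0, 0], ![-1, 0, 0], ![0, -1, 0], ![0, 0, -1], ![-1, 0, -1], ![0, -1, -1]]

/-- ★ KERNEL SMOKE: the curvature leaf accepts the six-bond box of half-width `2⁻¹¹` at floor `λ = 2` (`lamS = 2·SC`).  MEASURED (compiled
`#eval`, hand-1 g26): per-label `α ∈ [9.7, 13.6]`, `β ∈ [−0.37, −0.10]`; Hessian entries diag `[7.4, 11.7]²`, `[35.9, 48.9]`, off-diagonal `±0.9`,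
`±2.4`, `±2.9` ⇒ row slack `4.1 / 3.6 / 30.6` (λ = 4 just fails); at half-width `2⁻⁹` the naive enclosure is too wide even for `λ = 0`
(off-diagonals `±3.8`, `±9.8`): the NAIVE interval Hessian works at `2⁻¹¹`, a centred/Lipschitz Hessian enclosure is needed for coarser ξ-boxes. -/
theorem curvCheck_smoke : curvCheck cSmoke wSmoke sixLabels (2 * 281474976710656) = true := by
  decide +kernel

end Summit.AtomisticToContinuum.Crystallization.Theorems.FrustratedLawDichotomyStrainedPatchHomCurvLeaf
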